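import Summits.ResolutionOfSingularities.ResolutionOfSingularities.Theorems.WildQuotientsSummitReductionStubPairEquivariantFibrationTensorLemmas
import Summits.ResolutionOfSingularities.ResolutionOfSingularities.Theorems.WildQuotientsSummitReductionStubPairEquivariantFibrationFieldLemmas
import Summits.ResolutionOfSingularities.ResolutionOfSingularities.Theorems.WildQuotientsSummitReductionStubPairEquivariantFibrationGenericFibreLemmas
import Summits.ResolutionOfSingularities.ResolutionOfSingularities.Theorems.WildQuotientsSummitReductionStubPairEquivariantFibrationModelLemmas
import Summits.ResolutionOfSingularities.ResolutionOfSingularities.Theorems.WildQuotientsSummitReductionStubPairEquivariantFibrationClosureLemmas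
import Literature.AlgebraicGeometry.Resolution.AlterationsSemiStableResolution
import Literature.AlgebraicGeometry.Resolution.DerivativeIdealsSupport
import Literature.AlgebraicGeometry.Resolution.PatchingMorphismStep
import Mathlib.AlgebraicGeometry.Geometrically.Irreducible
import HarnessLib

/-!
# `WildQuotients.SummitReduction` (stmt-ResolutionOfSingularities-16324), line `FramePerfect`, skeleton v6:
# stub `stub_pair_equivariantFibration` (de Jong 1997 Lemma 5.2 over Spec k: equivariant fibration in curves)

Route `ResolutionOfSingularities/WildQuotients`, crux `SummitReduction`; registered stub of the line skeleton
`Cruxes/SummitReduction/Lines/FramePerfect.lean` (v6, lead c4). PROVED here, assembling the five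
helper files `…StubPairEquivariantFibration{Tensor,Field,GenericFibre,Model,Closure}Lemmas`:

1. `K = K(X)` with its `k`-structure; `X` as a projective model of `K/k` (`ProjModel`); the action
   `γ : G →* (K ≃ₐ[k] K)` (`exists_algEquivHom_functionField`); `trdeg_k K = d + 1` from
   `dim X = d + 1`.
2. The field datum of de Jong's proof over the perfect `k` (`exists_invariant_isAlgClosedIn_subfield`):
   `G`-invariant algebraically independent `x₁, …, x_d`, `F = k(x)`, `L` = algebraic closure of `F`
   in `K` (`G`-stable, finite over `F`, relatively algebraically closed in `K`, `K/L(x₀)` separable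
   algebraic, `trdeg_k L = d`, `trdeg_L K = 1`).
3. `Y` := the normalization of a projective model of `F` in `L`, a projective model of `L/k` with
   `G`-action (`exists_projModel_normalizationIn_equivariant`) — it replaces de Jong's Stein
   factorization `X' → Y → P^{d-1}` (same function field `L`); `X'` := the closure of the graph of
   `X ⇢ Y` in `X ×ₖ Y` with the diagonal action (`exists_closureModel_equivariant`): an equivariant
   modification `φ : X' → X` and an equivariant `fc : X' → Y`.
4. The generic fibre of `fc`: geometrically irreducible since `K ⊗_L M` is a domain for every field
   `M` (Lang VIII §4 in any characteristic, `isDomain_tensorProduct_of_isAlgClosedIn_of_separating`,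
   and `geometricallyIrreducible_fiberToSpecResidueField_genericPoint`), of dimension `trdeg_L K = 1`
   (`topologicalKrullDim_fiber_genericPoint`); `dim Y = trdeg_k L = d`.
-/

set_option linter.dupNamespace false

noncomputable section

open CategoryTheory CategoryTheory.Limits AlgebraicGeometry TopologicalSpace
open Literature.AlgebraicGeometry.Resolution
open Literature.AlgebraicGeometry.Motives (RatFn.functionFieldMap RatFn.functionFieldMap_comp)
open Literature.AlgebraicGeometry
open scoped TensorProduct IntermediateField

namespace Summit.ResolutionOfSingularities.ResolutionOfSingularities.Theorems

/-- STUB 1a, PROVED. **De Jong 1997, Lemma 5.2 over `S = Spec k`, `k` perfect** (≡ de Jong 1996,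
4.11 with 7.10): let `G` act `k`-linearly on a projective integral `X` of dimension `d + 1`. Then
there are a `G`-equivariant projective modification `φ : X' → X` and a `G`-equivariant
`k`-morphism `fc : X' → Y` onto an integral projective `G`-variety `Y` of dimension `d` whose
generic fibre is a geometrically irreducible curve. Proof (this tree): `K(X)^G` is finitely
generated over the perfect `k`, so it has a separating transcendence basis `x₀, …, x_d`; with
`L` the algebraic closure of `k(x₁, …, x_d)` in `K(X)` — a `G`-stable subfield, relatively
algebraically closed, `K(X)/L(x₀)` separable — take `Y` the normalization in `L` of a projective
model of `k(x₁, …, x_d)` (`G` acts by functoriality of normalization) and `X'` the closure of the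
graph of `X ⇢ Y` in `X ×ₖ Y` (`G` acts diagonally); the generic fibre of `X' → Y` has function
field `K(X)` over `K(Y) = L`, hence is geometrically irreducible (`K(X) ⊗_L M` is a domain for all
`M`, Lang VIII §4) of dimension `trdeg_L K(X) = 1`, and `dim Y = trdeg_k L = d`.
[cite: DeJong1997, Lemma 5.2, pp. 612–613] [cite: DeJong1996, Lemma 4.11 and 7.10, pp. 67–68, 89] -/
theorem stub_pair_equivariantFibration (k : Type) [Field k] [PerfectField k] (d : ℕ)
    (X : Scheme.{0}) [IsIntegral X] (f : X ⟶ Spec (.of k))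
    (hproj : Motives.IsProjectiveOver (Over.mk f))
    (G : Type) [Group G] [Finite G] (ρ : G →* Aut X) (hρ : ∀ g : G, (ρ g).hom ≫ f = f)
    (hdim : topologicalKrullDim X = (d + 1 : ℕ)) :
    ∃ (X' : Scheme.{0}) (_ : IsIntegral X') (φ : X' ⟶ X) (ρX' : G →* Aut X') (Y : Scheme.{0})
      (_ : IsIntegral Y) (q : Y ⟶ Spec (.of k)) (ρY : G →* Aut Y) (fc : X' ⟶ Y),
      IsModification φ ∧ (∀ g : G, (ρX' g).hom ≫ φ = φ ≫ (ρ g).hom) ∧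
      Motives.IsProjectiveOver (Over.mk (φ ≫ f)) ∧ Motives.IsProjectiveOver (Over.mk q) ∧
      (∀ g : G, (ρY g).hom ≫ q = q) ∧ (∀ g : G, (ρX' g).hom ≫ fc = fc ≫ (ρY g).hom) ∧
      fc ≫ q = φ ≫ f ∧ topologicalKrullDim Y = (d : ℕ) ∧
      topologicalKrullDim ↥(fc.fiber (genericPoint Y)) = 1 ∧
      GeometricallyIrreducible (fc.fiberToSpecResidueField (genericPoint Y)) := by
  classical
  /- 1. the function field `K`, `X` as a projective model, the action on `K`, `trdeg_k K` -/
  haveI : IsProper f := hproj.isProper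
  letI algK : Algebra k X.functionField :=
    ((X.presheaf.germ ⊤ (genericPoint X) trivial).hom.comp
      (f.appTop.hom.comp (Scheme.ΓSpecIso (.of k)).inv.hom)).toAlgebra
  have halg : ∀ c : k, algebraMap k X.functionField c =
      X.presheaf.germ ⊤ (genericPoint X) trivial (f.appTop ((Scheme.ΓSpecIso (.of k)).inv c)) :=
    fun _ => rfl
  have hgenπ : X.fromSpecStalk (genericPoint X) ≫ f =
      Spec.map (CommRingCat.ofHom (algebraMap k X.functionField)) := by
    have e : CommRingCat.ofHom (algebraMap k X.functionField) =
        (Scheme.ΓSpecIso (.of k)).inv ≫ f.appTop ≫ X.presheaf.germ ⊤ (genericPoint X) trivial :=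
      rfl
    rw [e, Spec.map_comp, Spec.map_comp, Category.assoc, ← Scheme.fromSpecStalk_toSpecΓ_assoc,
      ← Scheme.toSpecΓ_naturality_assoc, toSpecΓ_SpecMap_ΓSpecIso_inv, Category.comp_id]
  let MX : ProjModel k X.functionField :=
    { X := X
      π := f
      gen := X.fromSpecStalk (genericPoint X)
      gen_π := hgenπ
      isIntegral := inferInstance
      isProjectiveOver := hproj
      genericPt_eq := Scheme.fromSpecStalk_closedPoint
      isIso_stalkClosedPointTo := by
        rw [Scheme.stalkClosedPointTo_fromSpecStalk]; infer_instance }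
  obtain ⟨γ, hγ⟩ := exists_algEquivHom_functionField f halg ρ hρ
  -- `K/k` is finitely generated of transcendence degree `d + 1`
  haveI : Algebra.EssFiniteType k X.functionField := by
    letI : X.Over (Spec (.of k)) := ⟨f⟩
    haveI : LocallyOfFiniteType (X ↘ Spec (.of k)) := inferInstanceAs (LocallyOfFiniteType f)
    exact essFiniteType_stalk_overHom k X (genericPoint X)
  have htr : Algebra.trdeg k X.functionField = (d + 1 : ℕ) := by
    have hlt : Algebra.trdeg k X.functionField < Cardinal.aleph0 :=
      Motives.trdeg_functionField_lt_aleph0 f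
    have hn : Algebra.trdeg k X.functionField =
        (Cardinal.toNat (Algebra.trdeg k X.functionField) : Cardinal) :=
      (Cardinal.cast_toNat_of_lt_aleph0 hlt).symm
    have hdim' := MX.topologicalKrullDim_eq_of_trdeg hn
    change topologicalKrullDim X = _ at hdim'
    rw [hdim] at hdim'
    have : d + 1 = Cardinal.toNat (Algebra.trdeg k X.functionField) := by exact_mod_cast hdim'
    rw [hn, ← this]
  /- 2. the field datum -/
  obtain ⟨S, x₀, -, -, hSinv, hLfin, hLstab, hrac, hx₀, hsep, htrL, htrLK⟩ :=
    exists_invariant_isAlgClosedIn_subfield k X.functionField γ d htr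
  set F : IntermediateField k X.functionField := IntermediateField.adjoin k (S : Set X.functionField)
    with hF
  set L : IntermediateField F X.functionField := algebraicClosure F X.functionField with hL
  haveI := hLfin
  haveI := hsep
  haveI : IsScalarTower k L X.functionField := IsScalarTower.of_algebraMap_eq fun _ => rfl
  haveI : Algebra.EssFiniteType L X.functionField := Algebra.EssFiniteType.of_comp k L _
  -- `G` fixes `F = k(S)` and acts on `L` by `F`-automorphisms
  have hFfix : ∀ (g : G) (c : F), γ g (c : X.functionField) = c := by
    let KG : IntermediateField k X.functionField := IntermediateField.fixedField γ.range
    have hle : F ≤ KG := by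
      rw [hF, IntermediateField.adjoin_le_iff]
      intro s hs
      rw [SetLike.mem_coe, IntermediateField.mem_fixedField_iff]
      rintro _ ⟨g, rfl⟩
      exact hSinv g s hs
    intro g c
    exact (IntermediateField.mem_fixedField_iff _ _).mp (hle c.2) (γ g) ⟨g, rfl⟩
  have hinv : ∀ (g : G) (a : X.functionField), γ g⁻¹ (γ g a) = a := fun g a => by
    rw [← AlgEquiv.mul_apply, ← map_mul, inv_mul_cancel, map_one]; rfl
  have hinv' : ∀ (g : G) (a : X.functionField), γ g (γ g⁻¹ a) = a := fun g a => by
    rw [← AlgEquiv.mul_apply, ← map_mul, mul_inv_cancel, map_one]; rfl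
  let δ₀ : G → (L ≃ₐ[F] L) := fun g =>
    { toFun := fun a => ⟨γ g (a : X.functionField), hLstab g _ a.2⟩
      invFun := fun a => ⟨γ g⁻¹ (a : X.functionField), hLstab g⁻¹ _ a.2⟩
      left_inv := fun a => Subtype.ext (hinv g a)
      right_inv := fun a => Subtype.ext (hinv' g a)
      map_mul' := fun a b =>
        Subtype.ext (map_mul (γ g) (a : X.functionField) (b : X.functionField))
      map_add' := fun a b =>
        Subtype.ext (map_add (γ g) (a : X.functionField) (b : X.functionField))
      commutes' := fun c => Subtype.ext (hFfix g c) }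
  let δ : G →* (L ≃ₐ[F] L) :=
    { toFun := δ₀
      map_one' := by
        ext a
        change γ 1 (a : X.functionField) = a
        rw [map_one]; rfl
      map_mul' := fun g h => by
        ext a
        change γ (g * h) (a : X.functionField) = γ g (γ h (a : X.functionField))
        rw [map_mul]; rfl }
  /- 3. `Y` and `X'` -/
  obtain ⟨MF⟩ := nonempty_projModel_adjoin (k := k) S
  obtain ⟨MY, ρY, hρYπ, hρYgen⟩ := exists_projModel_normalizationIn_equivariant MF δ
  have hX : ∀ g : G, MX.gen ≫ (ρ g).hom =
      Spec.map (CommRingCat.ofHom ((γ g).symm : X.functionField →+* X.functionField)) ≫ MX.gen := by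
    intro g
    have e : CommRingCat.ofHom ((γ g).symm : X.functionField →+* X.functionField) =
        CommRingCat.ofHom (RatFn.functionFieldMap (ρ g).hom) := by
      congr 1; ext a; exact hγ g a
    rw [e]
    exact (specMap_functionFieldMap_fromSpecStalk (ρ g).hom).symm
  have hcompat : ∀ g : G, (algebraMap L X.functionField).comp ((δ g).symm : L →+* L) =
      ((γ g).symm : X.functionField →+* X.functionField).comp (algebraMap L X.functionField) := by
    intro g
    ext a
    change ((γ g⁻¹ (a : X.functionField) : X.functionField)) = (γ g).symm a
    rw [map_inv]
    rfl
  obtain ⟨X', φm, fc, ρX', hφG, hfcG, hfcπ, hgenfc⟩ :=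
    exists_closureModel_equivariant MX MY ρ hρ (fun g => ((γ g).symm : _ →+* _))
      (fun g c => (γ g).symm.commutes c) hX ρY hρYπ (fun g => ((δ g).symm : L →+* L)) hρYgen
      hcompat
  /- 4. the generic fibre and the dimensions -/
  have hdom : ∀ (M : Type) [Field M] [Algebra L M], IsDomain (X.functionField ⊗[L] M) :=
    fun M _ _ => isDomain_tensorProduct_of_isAlgClosedIn_of_separating hrac x₀ hx₀
  haveI hgi : GeometricallyIrreducible (fc.fiberToSpecResidueField (genericPoint MY.X)) :=
    geometricallyIrreducible_fiberToSpecResidueField_genericPoint X' MY fc hgenfc hdom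
  haveI : Subsingleton (Spec (MY.X.residueField (genericPoint MY.X)) : Scheme.{0}) :=
    inferInstanceAs (Subsingleton (PrimeSpectrum _))
  haveI : Nonempty (Spec (MY.X.residueField (genericPoint MY.X)) : Scheme.{0}) :=
    inferInstanceAs (Nonempty (PrimeSpectrum _))
  haveI : IrreducibleSpace (fc.fiber (genericPoint MY.X)) :=
    GeometricallyIrreducible.irreducibleSpace_of_subsingleton
      (f := fc.fiberToSpecResidueField (genericPoint MY.X))
  have hfib : topologicalKrullDim (fc.fiber (genericPoint MY.X)) = (1 : ℕ) :=
    topologicalKrullDim_fiber_genericPoint X' MY fc hgenfc hfcπ (by rw [Nat.cast_one]; exact htrLK)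
  have hdimY : topologicalKrullDim MY.X = d := MY.topologicalKrullDim_eq_of_trdeg htrL
  have hφf : φm.f ≫ f = X'.π := φm.f_π
  refine ⟨X'.X, X'.isIntegral, φm.f, ρX', MY.X, MY.isIntegral, MY.π, ρY, fc,
    ⟨X'.isIntegral, inferInstance, φm.isBirational⟩, hφG, ?_, MY.isProjectiveOver, hρYπ, hfcG,
    ?_, hdimY, ?_, hgi⟩
  · rw [hφf]; exact X'.isProjectiveOver
  · rw [hfcπ, hφf]
  · rw [hfib, Nat.cast_one]

end Summit.ResolutionOfSingularities.ResolutionOfSingularities.Theorems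

end
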